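import Literature.AlgebraicGeometry.HodgeTheory.SymmetricA3NonCommutationOfNotNilpotent
import Literature.AlgebraicGeometry.HodgeTheory.PhamBrieskornLocalisedMonodromyNotUnipotent
import Literature.AlgebraicGeometry.HodgeTheory.PencilFigureEightHomotopy
import HarnessLib

/-!
# hN from the localisation of the `A₃` monodromy: the glue of the programme A₃-TRACE
# (`SymmetricA3NonCommutation` ⟸ Picard–Lefschetz data on the two circles ∧ «THE transport around the `A₃` point is not unipotent»)

Family `hodge`, layer `Literature/AlgebraicGeometry/HodgeTheory`; theorems only (no definition, no named fact). Written by
the prover seat `hodge-nonav-prover-Bx` (g16, cell `hodge-nonav`) for the binder hN `SymmetricA3NonCommutation`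
(`stub_a3NonComm`) of crux K1-B `VeryGeneralSignCommutatorsInHg`
(`Summits/HodgeConjecture/HodgeConjecture/Theses/SignSymmetricPowers.lean`, stmt-HodgeConjecture-19716); programme memo
`HOME/memos/PROGRAMME-A3-TRACE-Bx-g16.md`. It assembles

* S2 `symmetricA3NonCommutation_of_not_isNilpotent` (commuting Picard–Lefschetz transports have unipotent product),
* littype's B5 `figureEight_ratTransport_eq_conj` (`T₁ ≫ T₂` is conjugate to THE transport along the big circle
  `b = R e^{2πiθ}` of the `b`-line at the parameter `a′`) and `movingCentre_ratTransport_eq_conj` (the big circle at `a′` and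
  the circle `C_R` around the `A₃` point `[f₁]` at `a′ = 0` have conjugate transports — the bifurcation clause keeps the
  deformation off the discriminant),
* S1 `not_isNilpotent_sub_one_of_localisedRotation_fiberOver` (a monodromy homeomorphism localising to a Pham–Brieskorn
  rotation `g`, `g⁴ = id`, `g² = ` a non-trivial coordinate rotation, is not unipotent on `Hⁿ(Y; ℚ)`),

into:

* `not_isNilpotent_trans_sub_one_of_circleTransport` — if no transport `T_C` along `C_R` has `T_C − 1` nilpotent, then for every
  `0 < |a′| < εa` with `3/2 |ψ a′| ≤ R < εb` no product `T₁ ≫ T₂` of THE transports along the two circles of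
  `SymmetricA3NonCommutation` has `T₁ ≫ T₂ − 1` nilpotent (conjugation invariance of nilpotency);
* **`symmetricA3NonCommutation_of_circleTransport_not_unipotent`** — hN (odd `n`) from (i) one- and two-nodal Picard–Lefschetz data
  on the circles, (ii) the bifurcation clause on `|a′| < εa`, `|b| < εb` with `3/2 |ψ| ≤ R < εb`, (iii) «no transport along `C_R` is
  unipotent»;
* **`symmetricA3NonCommutation_of_localisedRotation`** — the same with (iii) replaced by the GEOMETRIC localisation package at the
  `A₃` point (a monodromy homeomorphism `η` of `Y_s(ℂ)`, `s = [f₁ + R g₀]`, equal to `id` off an open `A`, conjugate on `A` through a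
  chart bijective on `Hₙ( · ; ℂ)` to a Pham–Brieskorn self-map `g` with `g⁴ = id`, `g∘g = ` the rotation by `v ≠ 1` of the last
  coordinate, and acting as THE transport along `C_R`) — this package, H-A3LOC, is the ONE remaining input of hN (the analytic
  port, memo §3 B4).

Nothing here constructs H-A3LOC; HC is not proved; rung F-H1 not moved.

## References

* [ArnoldGuseinzadeVarchenko2012] V. I. Arnold, S. M. Gusein-Zade, A. N. Varchenko, Singularities of Differentiable Maps II,
  Part I §1.1, §2.3, §5.2 (boundary singularity `B₂`).
* [VoisinHodgeII2003] C. Voisin, Hodge Theory and Complex Algebraic Geometry II, CUP 2003, §3.1.2, §3.2.1 Thm. 3.16.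
* [Hatcher2002] A. Hatcher, Algebraic Topology, CUP 2002, §1.1 Lemma 1.19.
-/

noncomputable section

open CategoryTheory AlgebraicGeometry MvPolynomial Function
open Literature.AlgebraicTopology.SingularHomology
open Literature.AlgebraicGeometry.Motives Literature.AlgebraicGeometry.Motives.UniversalHypersurface
open Literature.Geometry.ComplexAnalytic

namespace Literature.AlgebraicGeometry.HodgeTheory

section HodgeTheory

variable {n d : ℕ}

/-- Nilpotency of `T − 1` is invariant under conjugation by a linear equivalence: if `T₀ = K ≫ T₁ ≫ K⁻¹` then
`T₀ − 1` is nilpotent iff `T₁ − 1` is (`T₁ − 1 = K (T₀ − 1) K⁻¹`). [cite: VoisinHodgeII2003, §3.1.2] -/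
theorem isNilpotent_sub_one_iff_of_eq_conj {V W : Type*} [AddCommGroup V] [Module ℚ V] [AddCommGroup W] [Module ℚ W]
    {T₀ : V ≃ₗ[ℚ] V} {T₁ : W ≃ₗ[ℚ] W} (K : V ≃ₗ[ℚ] W) (h : T₀ = K.trans (T₁.trans K.symm)) :
    IsNilpotent (T₀.toLinearMap - 1) ↔ IsNilpotent (T₁.toLinearMap - 1) := by
  -- `T₁ - 1 = K (T₀ - 1) K⁻¹`
  have hconj : T₁.toLinearMap - 1 = K.conjAlgEquiv ℚ (T₀.toLinearMap - 1) := by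
    rw [map_sub, map_one]
    refine LinearMap.ext fun w => ?_
    rw [LinearMap.sub_apply, LinearMap.sub_apply, LinearEquiv.conjAlgEquiv_apply, LinearMap.comp_apply,
      LinearMap.comp_apply, h]
    simp only [LinearEquiv.coe_coe, LinearEquiv.trans_apply, LinearEquiv.apply_symm_apply]
  constructor
  · rintro ⟨k, hk⟩
    exact ⟨k, by rw [hconj, ← map_pow, hk, map_zero]⟩
  · rintro ⟨k, hk⟩
    refine ⟨k, ?_⟩
    apply (K.conjAlgEquiv ℚ).injective
    rw [map_pow, ← hconj, hk, map_zero]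

/-- **No product `T₁ ≫ T₂` is unipotent when no transport around the `A₃` point is.** Fix forms `f₁, g₂, g₀` of degree `d ≥ 1`,
a parameter `a′`, `ψ ≠ 0` and `R` with `3/2 |ψ| ≤ R` such that the members `f₁ + a′ g₂ + b g₀` with `0 ≠ b ≠ ψ`, `|b| ≤ R` and the
members `f₁ + (s a′) g₂ + R e^{2πiθ} g₀`, `s ∈ [0, 1]`, are nonsingular (the bifurcation clause), and a loop `C` at `s₀` with
forms `f₁ + R e^{2πiθ} g₀` such that NO rational transport `T_C` along `C` (degree `n`) has `T_C − 1` nilpotent. Then for every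
base point `t₀ = [f₁ + a′ g₂ + (ψ/2) g₀]` and circles `γ₁` (`b = (ψ/2)e^{2πiθ}`), `γ₂` (`b = ψ − (ψ/2)e^{2πiθ}`), THE transports
satisfy: `T₁ ≫ T₂ − 1` is not nilpotent (`T₁ ≫ T₂ ∼ T_B ∼ T_C` by the figure-eight and moving-centre conjugations).
[cite: Hatcher2002, §1.1 Lemma 1.19] [cite: VoisinHodgeII2003, §3.1.2] [cite: ArnoldGuseinzadeVarchenko2012, Part I §5.2] -/
theorem not_isNilpotent_trans_sub_one_of_circleTransport {f₁ g₂ g₀ : MvPolynomial (Fin (n + 2)) ℂ}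
    (hf₁ : f₁.IsHomogeneous d) (hg₂ : g₂.IsHomogeneous d) (hg₀ : g₀.IsHomogeneous d) (hd : 1 ≤ d)
    (hU : IsCohomologicallyLocallyTrivialOn (family ℂ n d) Set.univ) {a' ψ : ℂ} (hψ : ψ ≠ 0) {R : ℝ}
    (hR : 3 / 2 * ‖ψ‖ ≤ R)
    (hJ₁ : ∀ b : ℂ, b ≠ 0 → b ≠ ψ → ‖b‖ ≤ R → SmoothHypersurface.IsNonsingularForm ℂ (f₁ + a' • g₂ + b • g₀))
    (hJ₂ : ∀ s θ : unitInterval, SmoothHypersurface.IsNonsingularForm ℂ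
      (f₁ + (((s : ℝ) : ℂ) * a') • g₂ + ((R : ℂ) * Complex.exp (2 * Real.pi * Complex.I * ((θ : ℝ) : ℂ))) • g₀))
    {s₀ : ComplexPoints (base ℂ n d)} (C : Path s₀ s₀)
    (hC : ∀ θ : unitInterval, pointForm ℂ n d (C θ) =
      f₁ + ((R : ℂ) * Complex.exp (2 * Real.pi * Complex.I * ((θ : ℝ) : ℂ))) • g₀)
    (hNC : ∀ T : bettiCohomology (fiberOver (family ℂ n d) s₀) n ≃ₗ[ℚ] bettiCohomology (fiberOver (family ℂ n d) s₀) n,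
      IsRatTransport (family ℂ n d) n hU (loopClassUniv n d C) T → ¬ IsNilpotent (T.toLinearMap - 1))
    {t₀ : ComplexPoints (base ℂ n d)} (γ₁ γ₂ : Path t₀ t₀)
    (h₁ : ∀ θ : unitInterval, pointForm ℂ n d (γ₁ θ) =
      f₁ + a' • g₂ + (ψ / 2 * Complex.exp (2 * Real.pi * Complex.I * ((θ : ℝ) : ℂ))) • g₀)
    (h₂ : ∀ θ : unitInterval, pointForm ℂ n d (γ₂ θ) =
      f₁ + a' • g₂ + (ψ - ψ / 2 * Complex.exp (2 * Real.pi * Complex.I * ((θ : ℝ) : ℂ))) • g₀)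
    {T₁ T₂ : bettiCohomology (fiberOver (family ℂ n d) t₀) n ≃ₗ[ℚ] bettiCohomology (fiberOver (family ℂ n d) t₀) n}
    (hT₁ : IsRatTransport (family ℂ n d) n hU (loopClassUniv n d γ₁) T₁)
    (hT₂ : IsRatTransport (family ℂ n d) n hU (loopClassUniv n d γ₂) T₂) :
    ¬ IsNilpotent ((T₁.trans T₂).toLinearMap - 1) := by
  have hRpos : 0 < R := lt_of_lt_of_le (by positivity) hR
  -- the big circle `B` at the parameter `a′`: base point `[f₁ + a′ g₂ + R g₀]`
  have hJR : ∀ c' : ℂ, ‖c'‖ = |R| → SmoothHypersurface.IsNonsingularForm ℂ (f₁ + a' • g₂ + c' • g₀) := by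
    intro c' hc'
    rw [abs_of_pos hRpos] at hc'
    refine hJ₁ c' ?_ ?_ hc'.le
    · intro h0; rw [h0, norm_zero] at hc'; exact hRpos.ne' hc'.symm
    · intro hψ'; rw [hψ'] at hc'; nlinarith [norm_nonneg ψ]
  have hsm : ∀ {g : MvPolynomial (Fin (n + 2)) ℂ} (c : ℂ), g.IsHomogeneous d → (c • g).IsHomogeneous d :=
    fun c hg => by
      rw [MvPolynomial.smul_eq_C_mul]
      simpa using (MvPolynomial.isHomogeneous_C (Fin (n + 2)) c).mul hg
  have hFa : (f₁ + a' • g₂).IsHomogeneous d := hf₁.add (hsm a' hg₂)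
  have hJB : SmoothHypersurface.IsNonsingularForm ℂ (f₁ + a' • g₂ + (R : ℂ) • g₀) :=
    hJR (R : ℂ) (by rw [Complex.norm_real, Real.norm_eq_abs])
  set t₁ : ComplexPoints (base ℂ n d) := pointOfForm ℂ n d (hFa.add (hsm (R : ℂ) hg₀)) hJB with ht₁
  have ht₁F : pointForm ℂ n d t₁ = f₁ + a' • g₂ + (R : ℂ) • g₀ := pointForm_pointOfForm ℂ n d _ _
  obtain ⟨B, hB⟩ := exists_isPencilCircle (n := n) (d := d) hFa hg₀ hJR t₁ ht₁F
  -- transports along `B` and `C`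
  obtain ⟨TB, hTB⟩ := exists_isRatTransport_family hd n hU (loopClassUniv n d B)
  obtain ⟨TC, hTC⟩ := exists_isRatTransport_family hd n hU (loopClassUniv n d C)
  -- figure-eight: `T₁ ≫ T₂ = K (T_B) K⁻¹`
  obtain ⟨κ, K, -, -, hfig⟩ := figureEight_ratTransport_eq_conj hFa hg₀ hψ hR hJ₁ hd hU n γ₁ γ₂ B h₁ h₂ hB
  have hconj₁ := hfig T₁ T₂ TB hT₁ hT₂ hTB
  -- moving centre: `T_C = K′ (T_B) K′⁻¹`
  obtain ⟨α, K', -, -, hmov⟩ := movingCentre_ratTransport_eq_conj hf₁ hg₂ hg₀ a' (R : ℂ) hJ₂ hd hU n C B hC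
    (fun θ => by rw [hB θ])
  have hconj₂ := (hmov TC TB hTC hTB).1
  -- nilpotency passes along the two conjugations
  intro hnil
  have hB' : IsNilpotent (TB.toLinearMap - 1) := (isNilpotent_sub_one_iff_of_eq_conj K hconj₁).1 hnil
  have hC' : IsNilpotent (TC.toLinearMap - 1) := (isNilpotent_sub_one_iff_of_eq_conj K' hconj₂).2 hB'
  exact hNC TC hTC hC'

/-- **hN from «no transport around the `A₃` point is unipotent»** (odd `n`): `SymmetricA3NonCommutation n d f₁ g₀ g₂ ψ εa`
follows from (i) one-nodal Picard–Lefschetz data along the circles `γ₁` and two-nodal data along `γ₂` (for all `0 < |a′| < εa`),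
(ii) the bifurcation clause (`0 ≠ b ≠ ψ a′`, `|b| < εb` ⟹ `f₁ + a′g₂ + b g₀` nonsingular for `|a′| < εa`; `ψ a′ ≠ 0`;
`3/2 |ψ a′| ≤ R < εb`), and (iii) a loop `C` of forms `f₁ + R e^{2πiθ} g₀` along which no rational transport is unipotent.
[cite: ArnoldGuseinzadeVarchenko2012, Part I §5.2 and §2.3] [cite: VoisinHodgeII2003, §3.2.1 Thm. 3.16] -/
theorem symmetricA3NonCommutation_of_circleTransport_not_unipotent (hn : 1 ≤ n) (hd : 1 ≤ d) (hodd : Odd n)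
    {f₁ g₀ g₂ : MvPolynomial (Fin (n + 2)) ℂ} (hf₁ : f₁.IsHomogeneous d) (hg₀ : g₀.IsHomogeneous d)
    (hg₂ : g₂.IsHomogeneous d) {ψ : ℂ → ℂ} {εa εb R : ℝ} (hRb : R < εb)
    (hψ0 : ∀ a' : ℂ, ‖a'‖ < εa → a' ≠ 0 → ψ a' ≠ 0)
    (hψR : ∀ a' : ℂ, ‖a'‖ < εa → 3 / 2 * ‖ψ a'‖ ≤ R)
    (hJ : ∀ a' b : ℂ, ‖a'‖ < εa → ‖b‖ < εb → b ≠ 0 → b ≠ ψ a' →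
      SmoothHypersurface.IsNonsingularForm ℂ (f₁ + a' • g₂ + b • g₀))
    {s₀ : ComplexPoints (base ℂ n d)} (C : Path s₀ s₀)
    (hC : ∀ θ : unitInterval, pointForm ℂ n d (C θ) =
      f₁ + ((R : ℂ) * Complex.exp (2 * Real.pi * Complex.I * ((θ : ℝ) : ℂ))) • g₀)
    (hNC : ∀ (hU : IsCohomologicallyLocallyTrivialOn (family ℂ n d) Set.univ)
      (T : bettiCohomology (fiberOver (family ℂ n d) s₀) n ≃ₗ[ℚ] bettiCohomology (fiberOver (family ℂ n d) s₀) n),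
      IsRatTransport (family ℂ n d) n hU (loopClassUniv n d C) T → ¬ IsNilpotent (T.toLinearMap - 1))
    (hPL : ∀ (hU : IsCohomologicallyLocallyTrivialOn (family ℂ n d) Set.univ) (a' : ℂ), ‖a'‖ < εa → a' ≠ 0 →
      ∀ (t₀ : ComplexPoints (base ℂ n d)), pointForm ℂ n d t₀ = f₁ + a' • g₂ + (ψ a' / 2) • g₀ →
      ∀ (γ₁ γ₂ : Path t₀ t₀),
        (∀ θ : unitInterval, pointForm ℂ n d (γ₁ θ) =
          f₁ + a' • g₂ + (ψ a' / 2 * Complex.exp (2 * Real.pi * Complex.I * ((θ : ℝ) : ℂ))) • g₀) →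
        (∀ θ : unitInterval, pointForm ℂ n d (γ₂ θ) =
          f₁ + a' • g₂ + (ψ a' - ψ a' / 2 * Complex.exp (2 * Real.pi * Complex.I * ((θ : ℝ) : ℂ))) • g₀) →
        (∃ (δ : bettiCohomology (fiberOver (family ℂ n d) t₀) n) (c₁ : ℚ),
            IsPicardLefschetzData n d 1 hn hd hU γ₁ ![δ] c₁) ∧
        (∃ (δ₀ δ₁ : bettiCohomology (fiberOver (family ℂ n d) t₀) n) (c₂ : ℚ),
            IsPicardLefschetzData n d 2 hn hd hU γ₂ ![δ₀, δ₁] c₂)) :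
    SymmetricA3NonCommutation n d f₁ g₀ g₂ ψ εa := by
  refine symmetricA3NonCommutation_of_not_isNilpotent hn hd hodd fun hU a' ha ha0 t₀ ht₀ γ₁ γ₂ hγ₁ hγ₂ => ?_
  obtain ⟨hPL₁, hPL₂⟩ := hPL hU a' ha ha0 t₀ ht₀ γ₁ γ₂ hγ₁ hγ₂
  refine ⟨hPL₁, hPL₂, fun T₁ T₂ hT₁ hT₂ => ?_⟩
  have hεa : 0 < εa := lt_of_le_of_lt (norm_nonneg a') ha
  have hRpos : 0 < R := by
    have h := hψR a' ha
    have hψ' : 0 < ‖ψ a'‖ := norm_pos_iff.2 (hψ0 a' ha ha0)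
    linarith
  refine not_isNilpotent_trans_sub_one_of_circleTransport hf₁ hg₂ hg₀ hd hU (hψ0 a' ha ha0) (hψR a' ha)
    (fun b hb0 hbψ hbR => hJ a' b ha (lt_of_le_of_lt hbR hRb) hb0 hbψ) (fun s θ => ?_) C hC (hNC hU) γ₁ γ₂ hγ₁ hγ₂ hT₁ hT₂
  -- the moving circle stays off the discriminant: `|s a′| < εa`, `b = R e^{2πiθ}` has `|b| = R`, so `b ≠ 0` and `b ≠ ψ(s a′)`
  have hs : ‖((s : ℝ) : ℂ) * a'‖ < εa := by
    rw [norm_mul, Complex.norm_real, Real.norm_eq_abs, abs_of_nonneg s.2.1]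
    exact lt_of_le_of_lt (mul_le_of_le_one_left (norm_nonneg _) s.2.2) ha
  have hb : ‖(R : ℂ) * Complex.exp (2 * Real.pi * Complex.I * ((θ : ℝ) : ℂ))‖ = R := by
    have he : 2 * Real.pi * Complex.I * ((θ : ℝ) : ℂ) = ((2 * Real.pi * (θ : ℝ) : ℝ) : ℂ) * Complex.I := by
      push_cast; ring
    rw [norm_mul, Complex.norm_real, Real.norm_eq_abs, abs_of_pos hRpos, he, Complex.norm_exp_ofReal_mul_I, mul_one]
  have h := hJ (((s : ℝ) : ℂ) * a') ((R : ℂ) * Complex.exp (2 * Real.pi * Complex.I * ((θ : ℝ) : ℂ))) hs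
    (by rw [hb]; exact hRb) (by intro h0; rw [h0, norm_zero] at hb; exact hRpos.ne' hb.symm)
    (by intro h0; have h3 := hψR _ hs; rw [← h0, hb] at h3; linarith)
  simpa [smul_smul] using h

/-- **hN from the GEOMETRIC localisation package at the `A₃` point (H-A3LOC)** (odd `n`, `n = m + 1`): as in
`symmetricA3NonCommutation_of_circleTransport_not_unipotent`, with (iii) supplied by a monodromy homeomorphism `η` of
`Y_{s₀}(ℂ)` which is the identity on an open `B`, maps an open `A` (`A ∪ B = Y_{s₀}(ℂ)`) to itself, is conjugate on `A` through a
chart `e : A → {Σ zᵢ^{aᵢ} = 1}` (all `aᵢ ≥ 2`) bijective on `Hₙ( · ; ℂ)` to a self-map `g` with `g⁴ = id` and `g ∘ g = ` the rotation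
of the last coordinate by `v ≠ 1`, and acts as every rational transport along `C` in degree `n`
(`not_isNilpotent_sub_one_of_localisedRotation_fiberOver`). This is the shape the analytic port at the `A₃` point delivers
(memo §3 B4: exponents `(2, …, 2, 4)`, `g` the weighted rotation `R_{2π}`, `v = −1`).
[cite: ArnoldGuseinzadeVarchenko2012, Part I §2.3 and §5.2] [cite: VoisinHodgeII2003, §3.2.1 Thm. 3.16] -/
theorem symmetricA3NonCommutation_of_localisedRotation {m d : ℕ} (hd : 1 ≤ d) (hodd : Odd (m + 1))
    {f₁ g₀ g₂ : MvPolynomial (Fin (m + 1 + 2)) ℂ} (hf₁ : f₁.IsHomogeneous d) (hg₀ : g₀.IsHomogeneous d)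
    (hg₂ : g₂.IsHomogeneous d) {ψ : ℂ → ℂ} {εa εb R : ℝ} (hRb : R < εb)
    (hψ0 : ∀ a' : ℂ, ‖a'‖ < εa → a' ≠ 0 → ψ a' ≠ 0)
    (hψR : ∀ a' : ℂ, ‖a'‖ < εa → 3 / 2 * ‖ψ a'‖ ≤ R)
    (hJ : ∀ a' b : ℂ, ‖a'‖ < εa → ‖b‖ < εb → b ≠ 0 → b ≠ ψ a' →
      SmoothHypersurface.IsNonsingularForm ℂ (f₁ + a' • g₂ + b • g₀))
    {s₀ : ComplexPoints (base ℂ (m + 1) d)} (C : Path s₀ s₀)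
    (hC : ∀ θ : unitInterval, pointForm ℂ (m + 1) d (C θ) =
      f₁ + ((R : ℂ) * Complex.exp (2 * Real.pi * Complex.I * ((θ : ℝ) : ℂ))) • g₀)
    -- H-A3LOC: the localisation package at the `A₃` point
    {A B : Set (ComplexPoints (fiberOver (family ℂ (m + 1) d) s₀))} (hAo : IsOpen A) (hBo : IsOpen B)
    (hAB : A ∪ B = Set.univ)
    (η : ComplexPoints (fiberOver (family ℂ (m + 1) d) s₀) ≃ₜ ComplexPoints (fiberOver (family ℂ (m + 1) d) s₀))
    (hB : ∀ y ∈ B, η y = y) (hA : C(↥A, ↥A)) (hhA : ∀ x : ↥A, ((hA x : ↥A) : _) = η x)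
    {a : Fin (m + 2) → ℕ} (h2 : ∀ i, 2 ≤ a i) (e : C(↥A, ↥(PhamBrieskorn.fibre a)))
    (hbij : Bijective (singularHomology.map ℂ ℂ e (m + 1)).hom)
    (g : C(↥(PhamBrieskorn.fibre a), ↥(PhamBrieskorn.fibre a))) (hconj : (e.comp hA).Homotopic (g.comp e))
    (hg4 : ∀ z, g (g (g (g z))) = z) (v : PhamBrieskorn.Omega (a (Fin.last (m + 1)))) (hv : (v : ℂ) ≠ 1)
    (hg2 : ∀ z, g (g z) = PhamBrieskorn.rotateFibre a (fun i => by have := h2 i; omega) v z)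
    (hT : ∀ (hU : IsCohomologicallyLocallyTrivialOn (family ℂ (m + 1) d) Set.univ)
      (T : bettiCohomology (fiberOver (family ℂ (m + 1) d) s₀) (m + 1) ≃ₗ[ℚ]
        bettiCohomology (fiberOver (family ℂ (m + 1) d) s₀) (m + 1)),
      IsRatTransport (family ℂ (m + 1) d) (m + 1) hU (loopClassUniv (m + 1) d C) T →
        ∀ x, T x = (singularCohomology.map ℚ ℚ
          (η : C(ComplexPoints (fiberOver (family ℂ (m + 1) d) s₀), ComplexPoints (fiberOver (family ℂ (m + 1) d) s₀)))
          (m + 1)).hom x)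
    -- Picard–Lefschetz data on the two circles
    (hPL : ∀ (hU : IsCohomologicallyLocallyTrivialOn (family ℂ (m + 1) d) Set.univ) (a' : ℂ), ‖a'‖ < εa → a' ≠ 0 →
      ∀ (t₀ : ComplexPoints (base ℂ (m + 1) d)), pointForm ℂ (m + 1) d t₀ = f₁ + a' • g₂ + (ψ a' / 2) • g₀ →
      ∀ (γ₁ γ₂ : Path t₀ t₀),
        (∀ θ : unitInterval, pointForm ℂ (m + 1) d (γ₁ θ) =
          f₁ + a' • g₂ + (ψ a' / 2 * Complex.exp (2 * Real.pi * Complex.I * ((θ : ℝ) : ℂ))) • g₀) →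
        (∀ θ : unitInterval, pointForm ℂ (m + 1) d (γ₂ θ) =
          f₁ + a' • g₂ + (ψ a' - ψ a' / 2 * Complex.exp (2 * Real.pi * Complex.I * ((θ : ℝ) : ℂ))) • g₀) →
        (∃ (δ : bettiCohomology (fiberOver (family ℂ (m + 1) d) t₀) (m + 1)) (c₁ : ℚ),
            IsPicardLefschetzData (m + 1) d 1 (Nat.succ_pos m) hd hU γ₁ ![δ] c₁) ∧
        (∃ (δ₀ δ₁ : bettiCohomology (fiberOver (family ℂ (m + 1) d) t₀) (m + 1)) (c₂ : ℚ),
            IsPicardLefschetzData (m + 1) d 2 (Nat.succ_pos m) hd hU γ₂ ![δ₀, δ₁] c₂)) :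
    SymmetricA3NonCommutation (m + 1) d f₁ g₀ g₂ ψ εa :=
  symmetricA3NonCommutation_of_circleTransport_not_unipotent (Nat.succ_pos m) hd hodd hf₁ hg₀ hg₂ hRb hψ0 hψR hJ C hC
    (fun hU T hTC => not_isNilpotent_sub_one_of_localisedRotation_fiberOver hd hAo hBo hAB η hB hA hhA h2 e hbij g hconj hg4
      v hv hg2 T (hT hU T hTC)) hPL

end HodgeTheory

end Literature.AlgebraicGeometry.HodgeTheory

end
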